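import Summits.AtomisticToContinuum.Crystallization.Theorems.FrustratedLawDichotomyTextureCoarseCore

/-!
# FrustratedLawDichotomy · crux `AperiodicFrustratedLawGap` (stmt-AtomisticToContinuum-27623) — the COARSE-SITE transfer, re-centred
# (decomp-a2c, prover hand 1, direct share, generation 6; second building block for the transfer of texture clause (5))

`not_goodEighth_of_coarse_matched`: deterministic, conditional form.  Let `S` be `δ`-separated, `y` a `7/10`-separated approximant two-way
`ε`-matched to `S` around the pair `(y i, p)` up to radius `R`, and `j'` a COARSE site of `y` (its punctured `13/10`-shell is NOT `1/8`-close to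
the pattern, for the fcc resp. hcp pattern) within `R₉` of `y i`, matched to the atom `p₁ ∈ S`.  Then `p₁` is not robustly `η`-good for that
pattern at any scale `d`, tolerance `η < 1/8` and gap `γ` that the matching resolves (`2d + γ + 2 ≤ R − R₉ − ε`, `80ε ≤ d(1 − 8η)`, `10ε ≤ γ`,
`8ε < δ`, `8ε < 7/10`): re-centre the matching at `(y j', p₁)` (tolerance `2ε`, radius `R − R₉ − ε`) and run
`good_transfer_core_eighth`.  What remains for the almost-sure «coarse sites are `(R₉ + ε)`-ubiquitous» statement is bookkeeping: the
candidate atoms within `R₉ + 1` of `p` are finitely many, so one of them is the matched coarse atom for matchings of arbitrarily large radius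
and small tolerance (pigeonhole), hence not robustly `1/8`-good for ALL parameters; then `measure_univ_le_mul_of_ubiquitous`.
All `[folklore]`.  No definitions, no `sorry`.
-/

noncomputable section

namespace Summit.AtomisticToContinuum.Crystallization.Theorems.FrustratedLawDichotomyTextureCoarseTransfer

open MeasureTheory Literature.Probability.Process Literature.Geometry.DiscreteGeometry
open Summit.AtomisticToContinuum.Crystallization.Theorems.FrustratedLawDichotomyTextureCoarseCore (good_transfer_core_eighth)

/-- **Re-centring a two-way matching.**  A two-way `ε`-matching of `S` by `y` around `(y i, p)` up to radius `R`, and a site `j'` within `R₉`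
of `y i` matched to `p₁ ∈ S`, give a two-way `2ε`-matching around `(y j', p₁)` up to radius `R − R₉ − ε`. [folklore] -/
theorem matching_recentre {S : Set (EuclideanSpace ℝ (Fin 3))} {N : ℕ} {y : Fin N → EuclideanSpace ℝ (Fin 3)} {i j' : Fin N} {p p₁ : EuclideanSpace ℝ (Fin 3)} {R R₉ ε : ℝ}
    (hm1 : ∀ s ∈ S, dist s p ≤ R → ∃ a : Fin N, dist (y a - y i) (s - p) ≤ ε)
    (hm2 : ∀ a : Fin N, dist (y a) (y i) ≤ R → ∃ s ∈ S, dist (y a - y i) (s - p) ≤ ε)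
    (hj' : dist (y j' - y i) (p₁ - p) ≤ ε) (hj'R₉ : dist (y j') (y i) ≤ R₉) (hε : 0 ≤ ε) :
    (∀ s ∈ S, dist s p₁ ≤ R - R₉ - ε → ∃ a : Fin N, dist (y a - y j') (s - p₁) ≤ 2 * ε) ∧
    (∀ a : Fin N, dist (y a) (y j') ≤ R - R₉ - ε → ∃ s ∈ S, dist (y a - y j') (s - p₁) ≤ 2 * ε) := by
  have hp₁p : dist p₁ p ≤ R₉ + ε := by
    have h1 : ‖(p₁ - p) - (y j' - y i)‖ ≤ ε := by rw [← dist_eq_norm, dist_comm]; exact hj'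
    calc dist p₁ p = ‖(y j' - y i) + ((p₁ - p) - (y j' - y i))‖ := by rw [dist_eq_norm]; congr 1; abel
      _ ≤ ‖y j' - y i‖ + ‖(p₁ - p) - (y j' - y i)‖ := norm_add_le _ _
      _ ≤ R₉ + ε := add_le_add (by rw [← dist_eq_norm]; exact hj'R₉) h1
  have key : ∀ (a : Fin N) (s : EuclideanSpace ℝ (Fin 3)), dist (y a - y i) (s - p) ≤ ε → dist (y a - y j') (s - p₁) ≤ 2 * ε := by
    intro a s h
    rw [dist_eq_norm] at h hj' ⊢
    calc ‖(y a - y j') - (s - p₁)‖ = ‖((y a - y i) - (s - p)) - ((y j' - y i) - (p₁ - p))‖ := by congr 1; abel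
      _ ≤ ‖(y a - y i) - (s - p)‖ + ‖(y j' - y i) - (p₁ - p)‖ := norm_sub_le _ _
      _ ≤ ε + ε := add_le_add h hj'
      _ = 2 * ε := by ring
  refine ⟨fun s hs hsR => ?_, fun a haR => ?_⟩
  · have hsp : dist s p ≤ R := by
      have := dist_triangle s p₁ p
      linarith
    obtain ⟨a, ha⟩ := hm1 s hs hsp
    exact ⟨a, key a s ha⟩
  · have hai : dist (y a) (y i) ≤ R := by
      have := dist_triangle (y a) (y j') (y i)
      linarith
    obtain ⟨s, hs, has⟩ := hm2 a hai
    exact ⟨s, hs, key a s has⟩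

/-- **COARSE SITE ⟹ its matched atom is not robustly good (conditional, deterministic).**  See the module docstring.  Stated for an
arbitrary kissing pattern `Pat` of unit vectors pairwise `≥ 1` apart (fcc and hcp both qualify), with «coarse» meaning: NO bijection of the
punctured `13/10·d_{j'}`-shell of `y j'` onto `Pat` is `1/8`-close after rescaling, for the given isometry `A`. [folklore] -/
theorem not_goodEighth_of_coarse_matched {S : Set (EuclideanSpace ℝ (Fin 3))} {δ : ℝ}
    (hS : ∀ x ∈ S, ∀ x' ∈ S, x ≠ x' → δ ≤ dist x x')
    {N : ℕ} {y : Fin N → EuclideanSpace ℝ (Fin 3)} {i j' : Fin N} {p p₁ : EuclideanSpace ℝ (Fin 3)} {R R₉ ε : ℝ}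
    (hsepY : ∀ a b : Fin N, a ≠ b → (7 : ℝ) / 10 ≤ dist (y a) (y b))
    (hm1 : ∀ s ∈ S, dist s p ≤ R → ∃ a : Fin N, dist (y a - y i) (s - p) ≤ ε)
    (hm2 : ∀ a : Fin N, dist (y a) (y i) ≤ R → ∃ s ∈ S, dist (y a - y i) (s - p) ≤ ε)
    (hp₁ : p₁ ∈ S) (hj' : dist (y j' - y i) (p₁ - p) ≤ ε) (hj'R₉ : dist (y j') (y i) ≤ R₉)
    {Pat : Finset (EuclideanSpace ℝ (Fin 3))} (hPat : Pat.Nonempty) (hPatn : ∀ u ∈ Pat, ‖u‖ = 1)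
    (hPat1 : ∀ u ∈ Pat, ∀ u' ∈ Pat, u ≠ u' → 1 ≤ dist u u')
    {A : EuclideanSpace ℝ (Fin 3) →ₗᵢ[ℝ] EuclideanSpace ℝ (Fin 3)}
    (hcoarse : ¬ ∃ e : ↥{z : EuclideanSpace ℝ (Fin 3) | z ∈ Set.range y ∧ z ≠ y j' ∧ dist z (y j') < 13 / 10 * sInf ((fun z => dist z (y j')) '' (Set.range y \ {y j'}))} ≃ ↥Pat,
      ∀ z : ↥{z : EuclideanSpace ℝ (Fin 3) | z ∈ Set.range y ∧ z ≠ y j' ∧ dist z (y j') < 13 / 10 * sInf ((fun z => dist z (y j')) '' (Set.range y \ {y j'}))},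
        dist ((sInf ((fun z => dist z (y j')) '' (Set.range y \ {y j'})))⁻¹ • ((z : EuclideanSpace ℝ (Fin 3)) - y j')) (A ((e z : ↥Pat) : EuclideanSpace ℝ (Fin 3))) ≤ 1 / 8)
    {d η γ : ℝ} {t : ↥Pat → EuclideanSpace ℝ (Fin 3)}
    (hε0 : 0 < ε) (hεη : 80 * ε ≤ d * (1 - 8 * η)) (hεγ : 10 * ε ≤ γ) (hεδ : 8 * ε < δ) (hε7 : 8 * ε < 7 / 10)
    (hR : 2 * d + γ + 2 ≤ R - R₉ - ε) :
    ¬ (0 < d ∧ 0 < γ ∧ η < 1 / 8 ∧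
        (∀ u : ↥Pat, t u ∈ S ∧ ‖(t u - p₁) - d • A (u : EuclideanSpace ℝ (Fin 3))‖ ≤ η * d) ∧
        (∀ s : EuclideanSpace ℝ (Fin 3), s ∈ S → s ≠ p₁ → d ≤ dist s p₁) ∧
        (∃ s : EuclideanSpace ℝ (Fin 3), s ∈ S ∧ s ≠ p₁ ∧ dist s p₁ ≤ d) ∧
        (∀ s : EuclideanSpace ℝ (Fin 3), s ∈ S → s ≠ p₁ → dist s p₁ < 13 / 10 * d + γ → dist s p₁ ≤ 13 / 10 * d - γ ∧ s ∈ Set.range t)) := by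
  rintro ⟨hd, hγ, hη, ht, hnn₁, hnn₂, hgap⟩
  obtain ⟨hm1', hm2'⟩ := matching_recentre hm1 hm2 hj' hj'R₉ hε0.le
  have hjj : dist (y j' - y j') (p₁ - p₁) ≤ 2 * ε := by
    rw [sub_self, sub_self, dist_self]; linarith
  have hnn₂' : ∃ s ∈ S, s ≠ p₁ ∧ dist s p₁ ≤ d := by
    obtain ⟨s, hs, h1, h2⟩ := hnn₂
    exact ⟨s, hs, h1, h2⟩
  obtain ⟨e, he⟩ := good_transfer_core_eighth hS hsepY hm1' hm2' hp₁ hjj hPat hPatn hPat1 hd hη ht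
    (fun s hs hsp => hnn₁ s hs hsp) hnn₂' (fun s hs hsp => hgap s hs hsp)
    (by linarith) (by linarith) (by linarith) (by linarith) (by linarith) hR rfl
  exact hcoarse ⟨e, he⟩

end Summit.AtomisticToContinuum.Crystallization.Theorems.FrustratedLawDichotomyTextureCoarseTransfer

end
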